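import Literature.Computability.Cryptography.CsidhGeneratorsOrder
import Literature.NumberTheory.QuadraticFields.BinaryQuadraticFormsRepresentation
import Literature.NumberTheory.LFunctions.DegreeOnePrimes
import Mathlib.GroupTheory.SpecificGroups.Cyclic.Basic
import HarnessLib

/-!
# Ideals of `ℤ[√-p]` prime to `2`: invertibility, primes of degree one, classes

Topic `Computability/Cryptography`; proof file (theorems only, no definition, no named fact), sequel
of `CsidhGeneratorsOrder.lean` (the embedding `ι : ℤ[√-p] → 𝓞 K` into the maximal order of the
quadratic field `K`, `2 𝓞 K ⊆ ι(ℤ[√-p])`, Cox's Prop. 7.20), towards the discharge of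
`Literature.Computability.Cryptography.Csidh.jmv_smallPrimesGenerate` (`CsidhGenerators.lean`):

* `isUnit_coe_of_odd_mem` — **an ideal of `ℤ[√-p]` containing an odd integer is invertible**
  (Cox, *Primes of the form x² + ny²*, Prop. 7.4 with Lemma 7.5, through the tree's Hermite normal
  form `exists_eq_span_mul_span`: `𝔟 = k (n, m + √-p)` with `n` odd, and the form
  `(n, -2m, (m² + p)/n)` is primitive — `isPrimitive_of_odd`: a common prime divisor `r` of
  `n, m, c` would give `r² ∣ nc - m² = p`), and `classOf_mul` — `classOf` is multiplicative on
  invertible ideals;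
* `exists_comap_eq_primeIdeal` — for a prime `v` of `𝓞 K` of prime norm `ℓ`,
  **`v ∩ ℤ[√-p] = (ℓ, t + √-p)`** (`primeIdeal p ℓ t`) for some `t` with `ℓ ∣ t² + p`
  (`𝓞 K / v` has prime order `ℓ`, hence is generated by `1`, so `√-p ≡ -t (mod v)` for an integer
  `t`; CSIDH's `𝔩 = (ℓ, π - λ)`);
* `exists_odd_mem_classOf_eq` — **every class of `cl(ℤ[√-p])` contains an invertible ideal
  containing an odd integer** (Cox, Cor. 7.17: the class is the class of a primitive positive
  definite form, Thm. 7.7, properly equivalent to one with odd leading coefficient, Lemmas 2.3 and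
  2.25 — tree `exists_properEquiv_isPosPrim_isCoprime_a`).

## References

* [Cox2013] D. A. Cox, *Primes of the form x² + ny²*, 2nd ed., Wiley 2013: §7.A Prop. 7.4,
  Lemma 7.5, Exercise 7.8; §7.B Thm. 7.7; §7.C Cor. 7.17, Prop. 7.20; §2.A Lemma 2.3, §2.C Lemma 2.25.
* [CastryckEtAl2018] W. Castryck, T. Lange, C. Martindale, L. Panny, J. Renes, *CSIDH*, ASIACRYPT 2018,
  §3 (`𝔩 = (ℓ, π - λ)`).
-/

noncomputable section

open scoped Classical nonZeroDivisors NumberField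

namespace Literature.Computability.Cryptography.Csidh

open Literature.NumberTheory.QuadraticFields.Quadratic
open Literature.NumberTheory.QuadraticFields.Quadratic.BinQF
open NumberField Module

attribute [local instance] isDomain_zsqrtd_neg

variable (p : ℕ) [Fact p.Prime]
variable {K : Type*} [Field K] [NumberField K] (ι : ℤ√(-(p : ℤ)) →+* 𝓞 K)

/-! ### Ideals of `ℤ[√-p]` containing an odd integer are invertible -/

omit [NumberField K] in
/-- **A form `(n, -2m, c)` with `n` odd and `m² + p = nc` is primitive**: a common prime divisor
`r` of `n, 2m, c` is odd, divides `m`, and `r² ∣ nc - m² = p`. [folklore] -/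
theorem isPrimitive_of_odd {n m c : ℤ} (hn : Odd n) (hc : m ^ 2 - -(p : ℤ) = n * c) :
    (⟨n, 2 * -m, c⟩ : BinQF).IsPrimitive := by
  have hp := (Fact.out : p.Prime)
  rw [isPrimitive_iff]
  intro r hrn hrb hrc
  by_contra hru
  have hr1 : r.natAbs ≠ 1 := fun h => hru (Int.isUnit_iff_natAbs_eq.2 h)
  obtain ⟨q, hq, hqr⟩ := Int.exists_prime_and_dvd hr1
  have hqn : q ∣ n := hqr.trans hrn
  have hq2 : ¬ q ∣ 2 := by
    intro h
    have : q ∣ n - 2 * (n / 2) := (dvd_sub hqn (h.mul_right _))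
    obtain ⟨k, hk⟩ := hn
    rw [hk, show 2 * k + 1 - 2 * ((2 * k + 1) / 2) = 1 by omega] at this
    exact hq.not_unit (isUnit_of_dvd_one this)
  have hqm : q ∣ m := by
    have : q ∣ 2 * -m := hqr.trans hrb
    rw [mul_neg, dvd_neg] at this
    exact (hq.dvd_or_dvd this).resolve_left hq2
  have hqc : q ∣ c := hqr.trans hrc
  have hqq : q * q ∣ (p : ℤ) := by
    have h1 : q * q ∣ n * c := mul_dvd_mul hqn hqc
    have h2 : q * q ∣ m ^ 2 := by rw [sq]; exact mul_dvd_mul hqm hqm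
    have : (p : ℤ) = n * c - m ^ 2 := by linear_combination hc
    rw [this]
    exact dvd_sub h1 h2
  -- `q.natAbs² ∣ p` with `q.natAbs ≥ 2`: impossible
  have hnat : q.natAbs * q.natAbs ∣ p := by
    have := Int.natAbs_dvd_natAbs.2 hqq
    rwa [Int.natAbs_mul, Int.natAbs_natCast] at this
  have hq1 : q.natAbs ≠ 1 := fun h => hq.not_unit (Int.isUnit_iff_natAbs_eq.2 h)
  have hq0 : q.natAbs ≠ 0 := by
    intro h
    rw [Int.natAbs_eq_zero] at h
    exact hq.ne_zero h
  rcases (Nat.dvd_prime hp).1 (dvd_of_mul_right_dvd hnat) with h | h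
  · exact hq1 h
  · have hle : q.natAbs * q.natAbs ≤ p := Nat.le_of_dvd hp.pos hnat
    rw [← h] at hle
    have h2le : 2 ≤ q.natAbs := by omega
    nlinarith

omit [NumberField K] in
/-- **An ideal of `ℤ[√-p]` containing an odd integer is invertible** (Cox, Prop. 7.4 with Lemma 7.5:
by the Hermite normal form `𝔟 = k · (n, m + √-p)`, `n ∣ m² + p` (tree `exists_eq_span_mul_span`),
`n` is odd, the form `(n, -2m, (m² + p)/n)` is primitive, and `(n, m + √-p)` is the invertible ideal
of that form, tree `isUnit_fracIdeal_of_isPosPrim`). [cite: Cox2013, §7.A Prop. 7.4 and Lemma 7.5] -/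
theorem isUnit_coe_of_odd_mem {𝔟 : Ideal (ℤ√(-(p : ℤ)))} {N : ℕ} (hN : Odd N)
    (hNb : (N : ℤ√(-(p : ℤ))) ∈ 𝔟) :
    IsUnit (𝔟 : FractionalIdeal (ℤ√(-(p : ℤ)))⁰ (FractionRing (ℤ√(-(p : ℤ))))) := by
  have hp := (Fact.out : p.Prime)
  have hd : (-(p : ℤ)) < 0 := by have := hp.pos; omega
  have hN0 : N ≠ 0 := fun h => by rw [h] at hN; exact (Nat.not_odd_zero hN)
  have h𝔟 : 𝔟 ≠ ⊥ := by
    intro h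
    rw [h, Ideal.mem_bot] at hNb
    exact hN0 (by exact_mod_cast hNb)
  obtain ⟨k, n, m, hk, hn, ⟨c, hc⟩, h𝔟eq⟩ := exists_eq_span_mul_span hd h𝔟
  -- `n ∣ N`, so `n` is odd
  have hnN : (n : ℤ) ∣ N := by
    rw [h𝔟eq, Ideal.mem_span_singleton_mul] at hNb
    obtain ⟨z, hz, hkz⟩ := hNb
    have hzim : z.im = 0 := by
      have := congrArg Zsqrtd.im hkz
      simp only [Zsqrtd.im_mul, Zsqrtd.re_intCast, Zsqrtd.im_intCast, zero_mul, add_zero,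
        Zsqrtd.im_natCast] at this
      rcases mul_eq_zero.1 this with h | h
      · exact absurd h hk
      · exact h
    have hzre : (k : ℤ) * z.re = N := by
      have := congrArg Zsqrtd.re hkz
      simpa [Zsqrtd.re_mul, hzim] using this
    have hmem : z ∈ Ideal.span {(n : ℤ√(-(p : ℤ))), ⟨-(-m), 1⟩} := by rwa [neg_neg]
    rw [mem_span_pair_iff (a := n) (β := -m) (c := c) (by linear_combination hc)] at hmem
    rw [hzim, mul_zero, add_zero] at hmem
    exact hmem.trans (Dvd.intro_left _ hzre)
  have hnodd : Odd n := by
    obtain ⟨q, hq⟩ := hnN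
    have hNodd : Odd (N : ℤ) := by exact_mod_cast hN
    rw [hq] at hNodd
    exact (Int.odd_mul.1 hNodd).1
  -- the form `(n, -2m, c)` and its (invertible) ideal `(n, m + √-p)`
  set f : BinQF := ⟨n, 2 * -m, c⟩ with hf
  have hfp : f.IsPosPrim (4 * -(p : ℤ)) := by
    refine ⟨?_, hn, isPrimitive_of_odd p hnodd hc⟩
    simp only [disc, hf]
    linear_combination (4 : ℤ) * hc
  have hideal : ideal (-(p : ℤ)) f = Ideal.span {(n : ℤ√(-(p : ℤ))), ⟨m, 1⟩} := by
    rw [ideal_eq_span_pair (f := f) (β := -m) rfl, neg_neg]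
  have hu : IsUnit ((Ideal.span {(n : ℤ√(-(p : ℤ))), ⟨m, 1⟩} : Ideal (ℤ√(-(p : ℤ)))) :
      FractionalIdeal (ℤ√(-(p : ℤ)))⁰ (FractionRing (ℤ√(-(p : ℤ))))) := by
    have := isUnit_fracIdeal_of_isPosPrim hfp
    rwa [fracIdeal, hideal] at this
  have hku : IsUnit ((Ideal.span {(k : ℤ√(-(p : ℤ)))} : Ideal (ℤ√(-(p : ℤ)))) :
      FractionalIdeal (ℤ√(-(p : ℤ)))⁰ (FractionRing (ℤ√(-(p : ℤ))))) := by
    rw [FractionalIdeal.coeIdeal_span_singleton]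
    have hk0 : algebraMap (ℤ√(-(p : ℤ))) (FractionRing (ℤ√(-(p : ℤ)))) (k : ℤ√(-(p : ℤ))) ≠ 0 := by
      rw [Ne, IsFractionRing.to_map_eq_zero_iff, Int.cast_eq_zero]
      exact hk
    exact IsUnit.of_mul_eq_one _
      (FractionalIdeal.spanSingleton_mul_inv (FractionRing (ℤ√(-(p : ℤ)))) hk0)
  rw [h𝔟eq, FractionalIdeal.coeIdeal_mul]
  exact hku.mul hu

omit [NumberField K] in
/-- **`classOf` is multiplicative on invertible ideals** (the class group is a group of classes of
invertible ideals, Cox §7.A). [cite: Cox2013, §7.A (the ideal class group `C(𝒪)`)] -/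
theorem classOf_mul {I J : Ideal (ℤ√(-(p : ℤ)))}
    (hI : IsUnit (I : FractionalIdeal (ℤ√(-(p : ℤ)))⁰ (FractionRing (ℤ√(-(p : ℤ))))))
    (hJ : IsUnit (J : FractionalIdeal (ℤ√(-(p : ℤ)))⁰ (FractionRing (ℤ√(-(p : ℤ)))))) :
    classOf p (I * J) = classOf p I * classOf p J := by
  have hIJ : IsUnit ((I * J : Ideal (ℤ√(-(p : ℤ)))) :
      FractionalIdeal (ℤ√(-(p : ℤ)))⁰ (FractionRing (ℤ√(-(p : ℤ))))) := by
    rw [FractionalIdeal.coeIdeal_mul]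
    exact hI.mul hJ
  rw [classOf_of_isUnit hI, classOf_of_isUnit hJ, classOf_of_isUnit hIJ, ← map_mul]
  congr 1
  ext : 1
  simp only [Units.val_mul, IsUnit.unit_spec, FractionalIdeal.coeIdeal_mul]

/-! ### Primes of degree one: `v ∩ ℤ[√-p] = (ℓ, t + √-p)` -/

omit [Fact p.Prime] in
/-- **A prime of `𝓞 K` of prime norm `ℓ` meets `ℤ[√-p]` in `(ℓ, t + √-p)`** for some `t` with
`ℓ ∣ t² + p`: the residue field `𝓞 K / v` has `ℓ` elements, so it is generated by `1` and
`√-p ≡ -t` for an integer `t`; then `(ℓ, t + √-p) ⊆ v ∩ ℤ[√-p]`, and conversely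
`x + y√-p ∈ v` gives `ℓ ∣ x - ty` (CSIDH's `𝔩 = (ℓ, π - λ)`).
[cite: CastryckEtAl2018, §3 (class-group action: "`𝔩 = (ℓ, π - λ)`")] -/
theorem exists_comap_eq_primeIdeal (v : IsDedekindDomain.HeightOneSpectrum (𝓞 K)) {ℓ : ℕ}
    (hℓ : ℓ.Prime) (hv : Ideal.absNorm v.asIdeal = ℓ) :
    ∃ t : ℤ, (ℓ : ℤ) ∣ t ^ 2 + p ∧ v.asIdeal.comap ι = primeIdeal p ℓ t := by
  haveI : Fact ℓ.Prime := ⟨hℓ⟩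
  obtain ⟨⟨hprime, hover⟩, -⟩ :=
    (Literature.NumberTheory.LFunctions.DegreeOnePrimes.absNorm_eq_prime_iff v.asIdeal).1 hv
  -- integers in `v`
  have hint : ∀ n : ℤ, (n : 𝓞 K) ∈ v.asIdeal ↔ (ℓ : ℤ) ∣ n := by
    intro n
    rw [← Ideal.mem_span_singleton, hover.over, Ideal.under_def, Ideal.mem_comap, eq_intCast]
  -- `𝓞 K / v` has prime order `ℓ`, generated by `1`
  have hcard : Nat.card (𝓞 K ⧸ v.asIdeal) = ℓ := by
    rw [← Submodule.cardQuot_apply, ← Ideal.absNorm_apply]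
    exact hv
  haveI : Nontrivial (𝓞 K ⧸ v.asIdeal) := Ideal.Quotient.nontrivial_iff.mpr hprime.ne_top
  obtain ⟨n, hn⟩ := AddSubgroup.mem_zmultiples_iff.1
    (mem_zmultiples_of_prime_card hcard (g := (1 : 𝓞 K ⧸ v.asIdeal)) one_ne_zero
      (g' := Ideal.Quotient.mk v.asIdeal (ι Zsqrtd.sqrtd)))
  set t : ℤ := -n with htdef
  have hst : ι Zsqrtd.sqrtd + (t : 𝓞 K) ∈ v.asIdeal := by
    have h1 : Ideal.Quotient.mk v.asIdeal (ι Zsqrtd.sqrtd) = Ideal.Quotient.mk v.asIdeal (n : 𝓞 K) := by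
      rw [← hn, zsmul_eq_mul, mul_one, map_intCast]
    rw [Ideal.Quotient.eq] at h1
    have e : ι Zsqrtd.sqrtd + (t : 𝓞 K) = ι Zsqrtd.sqrtd - (n : 𝓞 K) := by
      rw [htdef]; push_cast; ring
    rw [e]
    exact h1
  have hss : ι Zsqrtd.sqrtd * ι Zsqrtd.sqrtd = -(p : 𝓞 K) := emb_sqrtd_mul_self' p ι
  -- `ℓ ∣ t² + p`
  have hdvd : (ℓ : ℤ) ∣ t ^ 2 + p := by
    rw [← hint]
    have e : ((t ^ 2 + p : ℤ) : 𝓞 K) = (ι Zsqrtd.sqrtd + t) * ((t : 𝓞 K) - ι Zsqrtd.sqrtd) := by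
      push_cast
      linear_combination hss
    rw [e]
    exact v.asIdeal.mul_mem_right _ hst
  refine ⟨t, hdvd, le_antisymm ?_ ?_⟩
  · intro z hz
    rw [Ideal.mem_comap, emb_apply p ι] at hz
    obtain ⟨c', hc'⟩ := hdvd
    have hd' : (-t) ^ 2 - (ℓ : ℤ) * c' = -(p : ℤ) := by linear_combination hc'
    have hpI : primeIdeal p ℓ t = Ideal.span {((ℓ : ℤ) : ℤ√(-(p : ℤ))), ⟨-(-t), 1⟩} := by
      rw [primeIdeal, neg_neg, Int.cast_natCast]
    rw [hpI, mem_span_pair_iff hd']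
    rw [← hint]
    have e : ((z.re + -t * z.im : ℤ) : 𝓞 K) =
        ((z.re : 𝓞 K) + (z.im : 𝓞 K) * ι Zsqrtd.sqrtd) - (z.im : 𝓞 K) * (ι Zsqrtd.sqrtd + t) := by
      push_cast
      ring
    rw [e]
    exact v.asIdeal.sub_mem hz (v.asIdeal.mul_mem_left _ hst)
  · rw [primeIdeal, Ideal.span_le]
    rintro x (rfl | rfl)
    · rw [SetLike.mem_coe, Ideal.mem_comap, map_natCast]
      have := (hint ℓ).2 dvd_rfl
      exact_mod_cast this
    · rw [SetLike.mem_coe, Ideal.mem_comap, emb_mk p ι]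
      push_cast
      simpa [add_comm] using hst

/-! ### Every class contains an invertible ideal containing an odd integer (Cox, Cor. 7.17) -/

omit [NumberField K] in
/-- **Every ideal class of `ℤ[√-p]` contains an invertible ideal containing an odd integer**: the
class is the class of a primitive positive definite form (Cox, Thm. 7.7), which is properly
equivalent to one with odd leading coefficient `a` (Lemmas 2.3, 2.25), whose ideal
`(a, -b/2 + √-p) ∋ a` is invertible and in the same class (Cox, Cor. 7.17).
[cite: Cox2013, §7.C Cor. 7.17 with §7.B Thm. 7.7 and §2.C Lemma 2.25] -/
theorem exists_odd_mem_classOf_eq (C : ClassGroup (ℤ√(-(p : ℤ)))) :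
    ∃ (𝔟 : Ideal (ℤ√(-(p : ℤ)))) (N : ℕ), Odd N ∧ (N : ℤ√(-(p : ℤ))) ∈ 𝔟 ∧
      IsUnit (𝔟 : FractionalIdeal (ℤ√(-(p : ℤ)))⁰ (FractionRing (ℤ√(-(p : ℤ))))) ∧
      classOf p 𝔟 = C := by
  have hp := (Fact.out : p.Prime)
  have hd : (-(p : ℤ)) < 0 := by have := hp.pos; omega
  obtain ⟨f, ⟨hfp, -⟩, hfC⟩ := exists_isLabel_toClass_eq cox_formClassGroup_holds hd C
  obtain ⟨g, hfg, hgp, hga⟩ :=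
    exists_properEquiv_isPosPrim_isCoprime_a (D := 4 * -(p : ℤ)) (by omega) hfp (M := 2) two_ne_zero
  have hgC : toClass (-(p : ℤ)) g = C := by
    rw [← toClass_eq_of_properEquiv hd hfp hfg, hfC]
  have hga_odd : Odd g.a := by
    refine Int.not_even_iff_odd.1 ?_
    rintro ⟨r, hr⟩
    have h2 : (2 : ℤ) ∣ g.a := ⟨r, by rw [hr]; ring⟩
    have := hga.isUnit_of_dvd' h2 dvd_rfl
    rcases Int.isUnit_iff.1 this with h | h <;> norm_num at h
  refine ⟨ideal (-(p : ℤ)) g, g.a.natAbs, ?_, ?_, isUnit_fracIdeal_of_isPosPrim hgp, ?_⟩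
  · exact Int.natAbs_odd.2 hga_odd
  · have e : ((g.a.natAbs : ℕ) : ℤ√(-(p : ℤ))) = (g.a : ℤ√(-(p : ℤ))) := by
      ext <;> simp [abs_of_pos hgp.a_pos]
    rw [e, ideal]
    exact Ideal.subset_span (by simp)
  · rw [← toClass_eq_classOf, hgC]

end Literature.Computability.Cryptography.Csidh

end
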